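import Summits.HodgeConjecture.CorCM.MumfordTateRankSevenTypeThreeIsogeny
import Summits.HodgeConjecture.CorCM.MumfordTateRankSevenSimpleConverse
import Summits.HodgeConjecture.CorCM.MumfordTateRankOfPowers
import Literature.AlgebraicGeometry.HodgeTheory.RealSl2Blocks
import Literature.AlgebraicGeometry.HodgeTheory.RibetTotallyRealHodgeClasses
import HarnessLib

/-!
# The rung `dim MT(H¹(X)) = 7` with `ℚ`-SIMPLE Hodge Lie algebra, VI: the Mumford–Tate rank of the simple factor, and
# in the type-III position `dim B ≠ 2` — `(dim B, dim_ℚ End⁰B) ∈ {(4, 4), (8, 16)}`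

COR-CM (cell `pub-hodgecm2`, seat `b27` gen 42, count-neutral lane MT-RANK-SEVEN-TYPEIII; theorems only, no definition, no
named fact; UNCONDITIONAL — nothing here uses or asserts HC_CM).  Sequel of `CorCM/MumfordTateRankSevenTypeThreeIsogeny`
(gen 41): there, in the type-III position (`0 < dim X`, `𝔷 = 0`, `dim MT(H¹X) = 7`, `Lie Hg(H¹X)` `ℚ`-simple,
`dim 𝔤⁺ = dim 𝔤⁻ = 1`) `X ∼ B^{m+1}` is isotypic with `B` simple, `Z(End⁰B) = ℚ`, `4 dim_ℚ End⁰B = (dim B)²`, and the pair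
`(dim B, dim_ℚ End⁰B)` was left in `{(2,1), (4,4), (8,16)}` — the value `(2,1)` (a power of an abelian surface with
`End⁰ = ℚ`) being a phantom of the arithmetic that gen 41 could not remove for want of the transfer of the Mumford–Tate
rank to the factor.  That transfer is now a tree theorem: `dim Lie Hg(H¹(B^{m+1})) = dim Lie Hg(H¹B)`
(`Motives/HodgeLieOfAbelianVarietyPower`, from the diagonal `Δ 𝔥(H) ⊆ 𝔥(H^{⊕ι})` of `Motives/HodgeLieDiagonal`,
Moonen–Zarhin 1999 §1 «`Hg(Xⁿ) = Hg(X)` acting diagonally»).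

* §1 = `CorCM/MumfordTateRankOfPowers` (**`mtRank_hodge_one_eq_of_isIsogenous_biproduct_const`** / **`…_powSucc`**: for EVERY
  complex abelian variety `X ∼ B^{m+1}`, `0 < dim B`: `dim MT(H¹X) = dim MT(H¹B)`), imported.
* §2 **`dim_ne_two_of_isSimple_of_isIsogenous_biproduct_const_of_finrank_gradingPlus_eq_one`** — in the type-III position
  a simple `B` with `X ∼ B^{m+1}` and `4 dim_ℚ End⁰B = (dim B)²` has `dim B ≠ 2`.  PROOF: were `dim B = 2`, then
  `End⁰B = ℚ` is a totally real field, so `B` has no factor of type IV (`hasNoTypeIVFactor_of_isTotallyReal`) and, by §1,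
  `dim MT(H¹B) = 7`; gen 41's four-position classification of the rung `t = 7`, `𝔷 = 0`
  (`classification_typeThree_of_hasNoTypeIVFactor_of_mtRank_eq_seven`) APPLIED TO `B` gives: (i) `B ∼ B₁^{a+1} × B₂^{b+1}`
  with `B₁ ≁ B₂` of positive dimension — impossible for the simple surface `B` (its simple factor `B₁ ≼ B` is isogenous to
  `B`, `exists_isIsogenous_of_isSimple_of_avDominatedBy_biproduct`, so `dim B₁ = 2` and the dimension count fails); (ii)
  type III numerics `4 ∣ dim B = 2`; (iii)/(iv) `dim_ℚ End⁰B = 2(m'+1)²` or `8(m'+1)²`, not `1`.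
* §3 **`exists_isIsogenous_power_fourfold_or_eightfold_of_isSimple_of_finrank_gradingPlus_eq_one`** — the refined shape
  theorem: `X ∼ B^{m+1}`, `B` simple with `dim MT(H¹B) = 7`, `Z(End⁰B) = ℚ`, and
  **`(dim B, dim_ℚ End⁰B) ∈ {(4, 4), (8, 16)}`**: a simple abelian FOURFOLD with quaternion multiplication over `ℚ`
  (Moonen–Zarhin (2.3) Type III) or — the one remaining phantom, removable only by Albert's classification (a central
  division algebra of degree `4` over `ℚ` carries no positive involution of the first kind), which is not in the tree — a
  simple eightfold with a central division algebra of degree `4`.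
* §4 **`shape_of_center_eq_bot_of_mtRank_eq_seven`**, **`shape_of_hasNoTypeIVFactor_of_mtRank_eq_seven`** — the rung
  `t = 7`, `𝔷 = 0` in four positions, now ALL with isogeny shapes (gen 41's classification had numerics only in position (ii)).

## References

* [MoonenZarhin1999LowDim] B. Moonen, Yu. Zarhin, *Hodge classes on abelian varieties of low dimension*, Math. Ann.
  315 (1999), §1 («for `n ≥ 1` we can identify `Hg(Xⁿ)` with `Hg(X)`, acting diagonally») and §2 (2.3) (Type III).
* [MumfordAV1970] D. Mumford, *Abelian Varieties* (1970), §19 Cor. 1–2 of Thm. 1 (pp. 173–174), §21.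
* [Deligne1982HodgeCycles] P. Deligne, *Hodge cycles on abelian varieties*, LNM 900 (1982), I §3.1 and Prop. 3.4.
-/

noncomputable section

open scoped TensorProduct
open CategoryTheory CategoryTheory.Limits Module

namespace Summit.HodgeConjecture.CorCM

open Literature.AlgebraicGeometry.Motives
open Literature.AlgebraicGeometry.Motives.AbelianVariety
open Literature.AlgebraicGeometry.Motives.HodgeStructure
open Literature.AlgebraicGeometry.HodgeTheory
open Literature.AlgebraicGeometry.ComplexMultiplication (EndField)
open Literature.AlgebraicGeometry.Milne1999 (IsOfCMType)
open Literature.AlgebraicGeometry.Pohlmann1968 (isIsogenous_powSucc_biproduct)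
open Summit.HodgeConjecture.CorCM.Domination
open Summit.HodgeConjecture.CorCM.SliceExhaustion (avDominatedBy_prod_left)

variable [HodgeTensorFacts.{0, 0}] {X : AbelianVariety ℂ} {n : ℕ}

/-! ## §1 (moved) The Mumford–Tate rank of a power is that of the factor: `CorCM/MumfordTateRankOfPowers` -/

/-! ## §2 In the type-III position the simple factor is not a surface -/

/-- **A simple complex abelian SURFACE with `End⁰ = ℚ` does not have Mumford–Tate rank `7`** (its Hodge group is `Sp₄`,
of rank `11`; here only `≠ 7` is needed and proved): with `End⁰B = ℚ` the surface `B` has no factor of type IV, so gen 41's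
four-position classification of the rung `dim MT(H¹B) = 7`, `𝔷 = 0` applies to `B` — (i) the split shape
`B ∼ B₁^{a+1} × B₂^{b+1}` (`B₁ ≁ B₂`, both of positive dimension) contradicts the simplicity of `B` (the simple factor
`B₁ ≼ B` is isogenous to `B`); (ii) the type-III numerics give `4 ∣ dim B = 2`; (iii)/(iv) give `dim_ℚ End⁰B ∈ {2(m+1)²,
8(m+1)²} ∌ 1`. [cite: MoonenZarhin1999LowDim, §2 (2.1)–(2.3) and §3 (3.1)] [cite: MumfordAV1970, §19 Cor. 1–2 of Thm. 1 (pp. 173–174)] -/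
theorem mtRank_hodge_one_ne_seven_of_isSimple_surface_of_finrank_endAlgebra_eq_one {B : AbelianVariety ℂ} {k : ℕ}
    (hB : IsSmoothProjective k B.X) (hBs : B.IsSimple) (hB2 : B.dim = 2) (hE1 : Module.finrank ℚ B.endAlgebra = 1) :
    haveI := BettiUniverse.finite hB 1
    (BettiUniverse.hodge exists_isReal_hodgeModel_holds hB 1).mtRank ≠ 7 := by
  classical
  haveI := BettiUniverse.finite hB 1
  intro h7
  have hB0 : 0 < B.dim := by omega
  -- `End⁰B = ℚ` is the totally real field `ℚ`: no factor of type IV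
  have hF : IsField B.endAlgebra := isField_endAlgebra_of_finrank_eq_one hE1
  haveI := isTotallyReal_endField_of_finrank_eq_one hF hE1
  have hA4 : HasNoTypeIVFactor B := hasNoTypeIVFactor_of_isTotallyReal B hF
  rcases classification_typeThree_of_hasNoTypeIVFactor_of_mtRank_eq_seven hB hB0 hA4 h7 with h | h | h | h
  · -- (i) split shape: impossible for a simple surface
    obtain ⟨B₁, B₂, a, b, hB₁s, -, hB₁0, -, hB₂0, -, -, -, -, -, -, -, -, -, -, hBiso, hsum, -⟩ := h
    obtain ⟨g, hg⟩ := hBiso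
    -- `B ≅ ⨁_{Fin 1} B`
    let ι1 : (⨁ fun _ : Fin 1 => B) ≅ B := biproductUniqueIso (fun _ : Fin 1 => B)
    have hf : IsIsogeny ι1.inv := isIsogeny_hom_of_iso ι1.symm
    have hdom : AVDominatedBy B₁ (⨁ fun _ : Fin 1 => B) :=
      ((((avDominatedBy_powSucc_of_le B₁ (Nat.zero_le a)).trans (avDominatedBy_prod_left _ _)).trans_isIsogeny_inv
        hg).trans_isIsogeny_hom hf)
    obtain ⟨-, ⟨u, hu⟩⟩ := exists_isIsogenous_of_isSimple_of_avDominatedBy_biproduct (fun _ => hBs) hB₁s hB₁0 hdom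
    have hd : B₁.dim = B.dim := dim_eq_of_isIsogeny hu
    have hpos : 0 < (b + 1) * B₂.dim := Nat.mul_pos (Nat.succ_pos b) hB₂0
    rw [hd, hB2] at hsum
    omega
  · -- (ii) type III numerics: `4 ∣ dim B`
    obtain ⟨k', hk', hdim, -⟩ := h
    omega
  · -- (iii) real multiplication: `dim End⁰B = 2 (m+1)²`
    obtain ⟨-, m, -, -, -, -, -, -, -, hE, -⟩ := h
    rw [hE1] at hE
    have : 1 ≤ (m + 1) ^ 2 := Nat.one_le_pow _ _ (Nat.succ_pos m)
    omega
  · -- (iv) quaternion fourfold over a real quadratic field: `dim End⁰B = 8 (m+1)²`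
    obtain ⟨-, m, -, -, -, -, -, -, -, -, -, -, -, -, -, hE⟩ := h
    rw [hE1] at hE
    have : 1 ≤ (m + 1) ^ 2 := Nat.one_le_pow _ _ (Nat.succ_pos m)
    omega

/-- **In the type-III position of the rung `dim MT(H¹X) = 7`, a simple `B` with `X ∼ ⨁_{Fin (m+1)} B` and
`4 · dim_ℚ End⁰B = (dim B)²` is NOT a surface** — `dim MT(H¹B) = dim MT(H¹X) = 7` by §1, and a simple surface with
`4 dim End⁰B = 4`, i.e. `End⁰B = ℚ`, does not have Mumford–Tate rank `7`
(`mtRank_hodge_one_ne_seven_of_isSimple_surface_of_finrank_endAlgebra_eq_one`).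
[cite: MoonenZarhin1999LowDim, §1 and §2 (2.3)] [cite: MumfordAV1970, §19 Cor. 1–2 of Thm. 1 (pp. 173–174)] -/
theorem dim_ne_two_of_isSimple_of_isIsogenous_biproduct_const_of_mtRank_eq_seven (hX : IsSmoothProjective n X.X)
    (h7 : haveI := BettiUniverse.finite hX 1
      (BettiUniverse.hodge exists_isReal_hodgeModel_holds hX 1).mtRank = 7)
    {B : AbelianVariety ℂ} (hBs : B.IsSimple) (hB0 : 0 < B.dim) {m : ℕ}
    (hXB : IsIsogenous X (⨁ fun _ : Fin (m + 1) => B)) (hE : 4 * Module.finrank ℚ B.endAlgebra = B.dim ^ 2) :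
    B.dim ≠ 2 := by
  haveI := BettiUniverse.finite hX 1
  intro hB2
  have hB : IsSmoothProjective B.dim B.X := AbelianVariety.isSmoothProjective_holds
  haveI := BettiUniverse.finite hB 1
  have hE1 : Module.finrank ℚ B.endAlgebra = 1 := by
    rw [hB2] at hE
    omega
  have h7B : (BettiUniverse.hodge exists_isReal_hodgeModel_holds hB 1).mtRank = 7 := by
    rw [← mtRank_hodge_one_eq_of_isIsogenous_biproduct_const hX hB hB0 hXB]
    exact h7
  exact mtRank_hodge_one_ne_seven_of_isSimple_surface_of_finrank_endAlgebra_eq_one hB hBs hB2 hE1 h7B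

/-! ## §3 The refined shape theorem of the type-III position -/

/-- **`X ∼ B^{m+1}` with `B` simple, `dim MT(H¹B) = 7`, `Z(End⁰B) = ℚ`, and `(dim B, dim_ℚ End⁰B) ∈ {(4, 4), (8, 16)}`** —
for `0 < dim X`, `𝔷 = 0`, `dim MT(H¹X) = 7`, `Lie Hg(H¹X)` `ℚ`-simple and `dim 𝔤⁺ = dim 𝔤⁻ = 1` (the type-III position).
gen 41's `exists_isIsogenous_power_of_isSimple_of_finrank_gradingPlus_eq_one` with the phantom `(2, 1)` removed by §2
(`Hg(Bⁿ) = Hg(B)`: the factor `B` has Mumford–Tate rank `7`, which no `End⁰ = ℚ` surface has).  Moonen–Zarhin (2.3)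
Type III is `(4, 4)`: `B` a simple abelian fourfold whose endomorphism algebra is a (definite) quaternion algebra over
`ℚ`; `(8, 16)` is the phantom removable only by Albert's classification (not in the tree).  Also recorded: `dim X = 4k`,
`dim X = (m+1) dim B`, `dim_ℚ End⁰X = 4k² = (m+1)² dim_ℚ End⁰B`.
[cite: MoonenZarhin1999LowDim, §1 and §2 (2.3)] [cite: MumfordAV1970, §19 Cor. 1–2 of Thm. 1 (pp. 173–174) and §21]
[cite: Deligne1982HodgeCycles, I §3.1 and Prop. 3.4] -/
theorem exists_isIsogenous_power_fourfold_or_eightfold_of_isSimple_of_finrank_gradingPlus_eq_one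
    (hX : IsSmoothProjective n X.X) (h0 : 0 < X.dim)
    (hz : haveI := BettiUniverse.finite hX 1
      (BettiUniverse.hodge exists_isReal_hodgeModel_holds hX 1).hodgeLie ⊓
        Subalgebra.toSubmodule (BettiUniverse.hodge exists_isReal_hodgeModel_holds hX 1).endAlg = ⊥)
    (h7 : haveI := BettiUniverse.finite hX 1
      (BettiUniverse.hodge exists_isReal_hodgeModel_holds hX 1).mtRank = 7)
    (hsimple : haveI := BettiUniverse.finite hX 1
      letI : LieRing (Module.End ℚ (bettiCohomology X.X 1)) := LieRing.ofAssociativeRing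
      ∀ 𝔏 : LieSubalgebra ℚ (Module.End ℚ (bettiCohomology X.X 1)),
        𝔏.toSubmodule = (BettiUniverse.hodge exists_isReal_hodgeModel_holds hX 1).hodgeLie → LieAlgebra.IsSimple ℚ 𝔏)
    {S : Type} [Fintype S] [DecidableEq S] {deg : S → ℤ} (e : Module.Basis S ℂ (ℂ ⊗[ℚ] bettiCohomology X.X 1))
    (hF : ∀ a, (BettiUniverse.hodge exists_isReal_hodgeModel_holds hX 1).F a = Submodule.span ℂ (e '' {σ | a ≤ deg σ}))
    (hFc : ∀ a, complexConj ((BettiUniverse.hodge exists_isReal_hodgeModel_holds hX 1).F a) =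
      Submodule.span ℂ (e '' {σ | deg σ ≤ ((1 : ℕ) : ℤ) - a}))
    (hp1 : haveI := BettiUniverse.finite hX 1
      Module.finrank ℂ ((BettiUniverse.hodge exists_isReal_hodgeModel_holds hX 1).hodgeLieC ⊓ Module.End.eigenspace
        (LinearMap.mulLeft ℂ (gradingEnd e deg) - LinearMap.mulRight ℂ (gradingEnd e deg)) 1 : Submodule ℂ _) = 1)
    (hm1 : haveI := BettiUniverse.finite hX 1
      Module.finrank ℂ ((BettiUniverse.hodge exists_isReal_hodgeModel_holds hX 1).hodgeLieC ⊓ Module.End.eigenspace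
        (LinearMap.mulLeft ℂ (gradingEnd e deg) - LinearMap.mulRight ℂ (gradingEnd e deg)) (-1) : Submodule ℂ _) = 1) :
    ∃ (B : AbelianVariety ℂ) (m k : ℕ), B.IsSimple ∧ 0 < B.dim ∧ IsIsogenous X (⨁ fun _ : Fin (m + 1) => B) ∧ 0 < k ∧
      X.dim = 4 * k ∧ X.dim = (m + 1) * B.dim ∧ Module.finrank ℚ X.endAlgebra = 4 * k ^ 2 ∧
      Module.finrank ℚ X.endAlgebra = (m + 1) ^ 2 * Module.finrank ℚ B.endAlgebra ∧
      Module.finrank ℚ (Subalgebra.center ℚ B.endAlgebra) = 1 ∧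
      4 * Module.finrank ℚ B.endAlgebra = B.dim ^ 2 ∧
      (haveI := BettiUniverse.finite (AbelianVariety.isSmoothProjective_holds (A := B)) 1
       (BettiUniverse.hodge exists_isReal_hodgeModel_holds (AbelianVariety.isSmoothProjective_holds (A := B)) 1).mtRank = 7) ∧
      ((B.dim = 4 ∧ Module.finrank ℚ B.endAlgebra = 4) ∨ (B.dim = 8 ∧ Module.finrank ℚ B.endAlgebra = 16)) := by
  haveI := BettiUniverse.finite hX 1
  obtain ⟨B, m, k, hBs, hB0, hXB, hk0, hdimX, hdimXB, hEX, hEXB, hZB, h4, hcases⟩ :=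
    exists_isIsogenous_power_of_isSimple_of_finrank_gradingPlus_eq_one hX h0 hz h7 hsimple e hF hFc hp1 hm1
  have hB : IsSmoothProjective B.dim B.X := AbelianVariety.isSmoothProjective_holds
  have h7B : haveI := BettiUniverse.finite hB 1
      (BettiUniverse.hodge exists_isReal_hodgeModel_holds hB 1).mtRank = 7 := by
    haveI := BettiUniverse.finite hB 1
    rw [← mtRank_hodge_one_eq_of_isIsogenous_biproduct_const hX hB hB0 hXB]
    exact h7
  have hne2 : B.dim ≠ 2 :=
    dim_ne_two_of_isSimple_of_isIsogenous_biproduct_const_of_mtRank_eq_seven hX h7 hBs hB0 hXB h4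
  refine ⟨B, m, k, hBs, hB0, hXB, hk0, hdimX, hdimXB, hEX, hEXB, hZB, h4, h7B, ?_⟩
  rcases hcases with ⟨h2, -⟩ | h | h
  · exact absurd h2 hne2
  · exact Or.inl h
  · exact Or.inr h

/-! ## §4 The rung `dim MT(H¹X) = 7`, `𝔷 = 0`: the four positions, all with isogeny shapes -/

/-- **The rung `dim MT(H¹X) = 7` with `𝔷 = 0`, in four positions WITH ISOGENY SHAPES** (gen 41's
`classification_typeThree_of_center_eq_bot_of_mtRank_eq_seven` with position (ii) refined from numerics to a shape):
(i) SPLIT `X ∼ B₁^{a+1} × B₂^{b+1}`, `B₁ ≁ B₂` non-CM elliptic curves / quaternion surfaces; (ii) TYPE III `X ∼ B^{m+1}`, `B` simple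
with `dim MT(H¹B) = 7`, `Z(End⁰B) = ℚ`, `(dim B, dim_ℚ End⁰B) ∈ {(4,4), (8,16)}` (a quaternion fourfold over `ℚ`, or the Albert
phantom), `dim X = 4k`, `dim_ℚ End⁰X = 4k²`; (iii) `X ∼ B^{m+1}`, `B` a simple surface with real multiplication (HC for all
powers); (iv) `X ∼ B^{m+1}`, `B` a simple fourfold with `dim_ℚ End⁰B = 8` and real quadratic centre.
[cite: MoonenZarhin1999LowDim, §1, §2 (2.1)–(2.3), §3 (3.1) and Cor. (3.7)] [cite: MumfordAV1970, §19 Cor. 1–2 of Thm. 1 (pp. 173–174) and §21] -/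
theorem shape_of_center_eq_bot_of_mtRank_eq_seven (hX : IsSmoothProjective n X.X) (h0 : 0 < X.dim)
    (hz : haveI := BettiUniverse.finite hX 1
      (BettiUniverse.hodge exists_isReal_hodgeModel_holds hX 1).hodgeLie ⊓
        Subalgebra.toSubmodule (BettiUniverse.hodge exists_isReal_hodgeModel_holds hX 1).endAlg = ⊥)
    (h7 : haveI := BettiUniverse.finite hX 1
      (BettiUniverse.hodge exists_isReal_hodgeModel_holds hX 1).mtRank = 7) :
    (∃ (B₁ B₂ : AbelianVariety ℂ) (a b : ℕ), B₁.IsSimple ∧ B₂.IsSimple ∧ 0 < B₁.dim ∧ B₁.dim ≤ 2 ∧ 0 < B₂.dim ∧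
        B₂.dim ≤ 2 ∧ ¬ IsOfCMType B₁ ∧ ¬ IsOfCMType B₂ ∧
        Module.finrank ℚ B₁.endAlgebra = B₁.dim ^ 2 ∧ Module.finrank ℚ (Subalgebra.center ℚ B₁.endAlgebra) = 1 ∧
        Module.finrank ℚ B₂.endAlgebra = B₂.dim ^ 2 ∧ Module.finrank ℚ (Subalgebra.center ℚ B₂.endAlgebra) = 1 ∧
        (∀ f : B₁ ⟶ B₂, f = 0) ∧ (∀ f : B₂ ⟶ B₁, f = 0) ∧ ¬ IsIsogenous B₁ B₂ ∧
        IsIsogenous X ((B₁.powSucc a).prod (B₂.powSucc b)) ∧ (a + 1) * B₁.dim + (b + 1) * B₂.dim = X.dim ∧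
        ¬ IsOfCMType X) ∨
      (∃ (B : AbelianVariety ℂ) (m k : ℕ), B.IsSimple ∧ 0 < B.dim ∧ IsIsogenous X (⨁ fun _ : Fin (m + 1) => B) ∧ 0 < k ∧
        X.dim = 4 * k ∧ X.dim = (m + 1) * B.dim ∧ Module.finrank ℚ X.endAlgebra = 4 * k ^ 2 ∧
        Module.finrank ℚ X.endAlgebra = (m + 1) ^ 2 * Module.finrank ℚ B.endAlgebra ∧
        Module.finrank ℚ (Subalgebra.center ℚ B.endAlgebra) = 1 ∧
        4 * Module.finrank ℚ B.endAlgebra = B.dim ^ 2 ∧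
        (haveI := BettiUniverse.finite (AbelianVariety.isSmoothProjective_holds (A := B)) 1
         (BettiUniverse.hodge exists_isReal_hodgeModel_holds (AbelianVariety.isSmoothProjective_holds (A := B)) 1).mtRank =
           7) ∧
        ((B.dim = 4 ∧ Module.finrank ℚ B.endAlgebra = 4) ∨ (B.dim = 8 ∧ Module.finrank ℚ B.endAlgebra = 16))) ∨
      (∃ (B : AbelianVariety ℂ) (m : ℕ) (hF : IsField B.endAlgebra),
        B.IsSimple ∧ B.dim = 2 ∧ Module.finrank ℚ B.endAlgebra = 2 ∧ NumberField.IsTotallyReal (EndField B hF) ∧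
        IsIsogenous X (B.powSucc m) ∧ X.dim = (m + 1) * 2 ∧ Module.finrank ℚ X.endAlgebra = (m + 1) ^ 2 * 2 ∧
        IsStablyNondegenerate X ∧ ∀ N : ℕ, HodgeConjectureFor (X.powSucc N).dim (X.powSucc N).X) ∨
      (∃ (B : AbelianVariety ℂ) (m : ℕ) (φ : B.endAlgebra) (q : ℚ),
        B.IsSimple ∧ B.dim = 4 ∧ Module.finrank ℚ B.endAlgebra = 8 ∧
        Module.finrank ℚ (Subalgebra.center ℚ B.endAlgebra) = 2 ∧ φ ∈ Subalgebra.center ℚ B.endAlgebra ∧ 0 < q ∧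
        ¬ IsSquare q ∧ φ * φ = algebraMap ℚ B.endAlgebra q ∧
        (∀ z ∈ Subalgebra.center ℚ B.endAlgebra, ∃ a b : ℚ, z = algebraMap ℚ B.endAlgebra a + b • φ) ∧
        IsIsogenous X (B.powSucc m) ∧ X.dim = (m + 1) * 4 ∧ Module.finrank ℚ X.endAlgebra = (m + 1) ^ 2 * 8) := by
  classical
  haveI := BettiUniverse.finite hX 1
  rcases isSimple_or_exists_isIsogenous_powSucc_prod_powSucc_of_center_eq_bot_of_mtRank_eq_seven hX h0 hz h7 with h | h
  · rcases trichotomy_of_isSimple_of_center_eq_bot_of_mtRank_eq_seven hX h0 hz h7 h with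
      ⟨S, hS, hD, deg, e, hF, hFc, ⟨hp1, hm1, -⟩, -⟩ | h' | h'
    · exact Or.inr (Or.inl
        (exists_isIsogenous_power_fourfold_or_eightfold_of_isSimple_of_finrank_gradingPlus_eq_one hX h0 hz h7 h e hF hFc
          hp1 hm1))
    · exact Or.inr (Or.inr (Or.inl h'))
    · exact Or.inr (Or.inr (Or.inr h'))
  · exact Or.inl h

/-- **The same four positions for every complex abelian variety with NO FACTOR OF TYPE IV and `dim MT(H¹X) = 7`**
(no type-IV factor ⟹ `𝔷 = 0`). [cite: MoonenZarhin1999LowDim, §1, §2 (2.1)–(2.3), §3 (3.1) and Cor. (3.7)] -/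
theorem shape_of_hasNoTypeIVFactor_of_mtRank_eq_seven (hX : IsSmoothProjective n X.X) (h0 : 0 < X.dim)
    (hA4 : HasNoTypeIVFactor X)
    (h7 : haveI := BettiUniverse.finite hX 1
      (BettiUniverse.hodge exists_isReal_hodgeModel_holds hX 1).mtRank = 7) :
    (∃ (B₁ B₂ : AbelianVariety ℂ) (a b : ℕ), B₁.IsSimple ∧ B₂.IsSimple ∧ 0 < B₁.dim ∧ B₁.dim ≤ 2 ∧ 0 < B₂.dim ∧
        B₂.dim ≤ 2 ∧ ¬ IsOfCMType B₁ ∧ ¬ IsOfCMType B₂ ∧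
        Module.finrank ℚ B₁.endAlgebra = B₁.dim ^ 2 ∧ Module.finrank ℚ (Subalgebra.center ℚ B₁.endAlgebra) = 1 ∧
        Module.finrank ℚ B₂.endAlgebra = B₂.dim ^ 2 ∧ Module.finrank ℚ (Subalgebra.center ℚ B₂.endAlgebra) = 1 ∧
        (∀ f : B₁ ⟶ B₂, f = 0) ∧ (∀ f : B₂ ⟶ B₁, f = 0) ∧ ¬ IsIsogenous B₁ B₂ ∧
        IsIsogenous X ((B₁.powSucc a).prod (B₂.powSucc b)) ∧ (a + 1) * B₁.dim + (b + 1) * B₂.dim = X.dim ∧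
        ¬ IsOfCMType X) ∨
      (∃ (B : AbelianVariety ℂ) (m k : ℕ), B.IsSimple ∧ 0 < B.dim ∧ IsIsogenous X (⨁ fun _ : Fin (m + 1) => B) ∧ 0 < k ∧
        X.dim = 4 * k ∧ X.dim = (m + 1) * B.dim ∧ Module.finrank ℚ X.endAlgebra = 4 * k ^ 2 ∧
        Module.finrank ℚ X.endAlgebra = (m + 1) ^ 2 * Module.finrank ℚ B.endAlgebra ∧
        Module.finrank ℚ (Subalgebra.center ℚ B.endAlgebra) = 1 ∧
        4 * Module.finrank ℚ B.endAlgebra = B.dim ^ 2 ∧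
        (haveI := BettiUniverse.finite (AbelianVariety.isSmoothProjective_holds (A := B)) 1
         (BettiUniverse.hodge exists_isReal_hodgeModel_holds (AbelianVariety.isSmoothProjective_holds (A := B)) 1).mtRank =
           7) ∧
        ((B.dim = 4 ∧ Module.finrank ℚ B.endAlgebra = 4) ∨ (B.dim = 8 ∧ Module.finrank ℚ B.endAlgebra = 16))) ∨
      (∃ (B : AbelianVariety ℂ) (m : ℕ) (hF : IsField B.endAlgebra),
        B.IsSimple ∧ B.dim = 2 ∧ Module.finrank ℚ B.endAlgebra = 2 ∧ NumberField.IsTotallyReal (EndField B hF) ∧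
        IsIsogenous X (B.powSucc m) ∧ X.dim = (m + 1) * 2 ∧ Module.finrank ℚ X.endAlgebra = (m + 1) ^ 2 * 2 ∧
        IsStablyNondegenerate X ∧ ∀ N : ℕ, HodgeConjectureFor (X.powSucc N).dim (X.powSucc N).X) ∨
      (∃ (B : AbelianVariety ℂ) (m : ℕ) (φ : B.endAlgebra) (q : ℚ),
        B.IsSimple ∧ B.dim = 4 ∧ Module.finrank ℚ B.endAlgebra = 8 ∧
        Module.finrank ℚ (Subalgebra.center ℚ B.endAlgebra) = 2 ∧ φ ∈ Subalgebra.center ℚ B.endAlgebra ∧ 0 < q ∧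
        ¬ IsSquare q ∧ φ * φ = algebraMap ℚ B.endAlgebra q ∧
        (∀ z ∈ Subalgebra.center ℚ B.endAlgebra, ∃ a b : ℚ, z = algebraMap ℚ B.endAlgebra a + b • φ) ∧
        IsIsogenous X (B.powSucc m) ∧ X.dim = (m + 1) * 4 ∧ Module.finrank ℚ X.endAlgebra = (m + 1) ^ 2 * 8) :=
  shape_of_center_eq_bot_of_mtRank_eq_seven hX h0 (hodgeLie_hodge_one_inf_endAlg_eq_bot_of_hasNoTypeIVFactor hX hA4) h7

end Summit.HodgeConjecture.CorCM

end
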